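import Summits.KontsevichZagierPeriods.KontsevichZagierPeriods.Theorems.RootDecompWalshStrataBall4Band

/-!
# The 4-ball specimen, addendum A: the quarter disc descends to a RATIONAL 1-cell

Route `RootDecompWalshStrata` (cell decomp-kz, lens 4, gen 11), support toward `QuadricSignKernel` (item
stmt-KontsevichZagierPeriods-25393).  The planar Dirichlet-polar chart `Φ(y) = (y₁(1 − y₀), y₁y₀)` (polynomial,
Jacobian `−y₁`, injective on `{y₁ > 0}`) maps `D₁ = {y₀ ∈ (0,1), y₁ > 0, 1 − (y₁(1−y₀))² − (y₁y₀)² > 0}` onto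
the quarter disc `Q = (0,1)² ∩ {1 − x₀² − x₁² > 0}` (rule (2)); `D₁` is the open band
`0 < y₁ < 1/√((1 − t)² + t²)` over `(0,1)`, and Newton–Leibniz along `y₁` (primitive `w·y₁²/2`, rule (3)) plus
opening the fibres (rule (1a)) lands on the RATIONAL 1-cell `arcRep w = [(0,1), w/(2((1 − t)² + t²))]` (value
`w·π/4`): `of_disc_sub_of_arcRep_mem_relations`.  (The cone specimen descended `Q` to the ALGEBRAIC weight
`√(1 − t²)`; the polar chart gives a rational one.)  0 sorry.  [KontsevichZagier2001 §1.2 rules (1)–(3)]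
-/

noncomputable section
/-- `(1 − v)² + v² > 0`. [folklore] -/
private theorem gq_pos (v : ℝ) : 0 < (1 - v) ^ 2 + v ^ 2 := by nlinarith [sq_nonneg (1 - 2 * v)]

open Literature.NumberTheory.Transcendental
open MeasureTheory Set
open MvPolynomial (aeval X C)
open Literature.ModelTheory.ExponentialFields (IsSemialgebraic isSemialgebraic_setOf_eval_pos
  isSemialgebraic_setOf_eval_lt continuous_aeval_real)
open Summit.KontsevichZagierPeriods.RootDecompWalshStrata.WalshSpanProof (isSemialgebraic_cubeSet
  isBounded_cubeSet cellRep cellRep_domain cellRep_integrand)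
open Summit.KontsevichZagierPeriods.RootDecompWalshStrata.ConeSpecimen (discPoly aeval_discPoly)

namespace Summit.KontsevichZagierPeriods.RootDecompWalshStrata.Ball4

/-! #### The base interval and the rational 1-cell `arcRep w = [(0,1), w/(2((1 − t)² + t²))]` -/

/-- The open unit interval `(0,1) ⊆ ℝ¹`. -/
def ivSet : Set (Fin 1 → ℝ) := {t | ∀ j, 0 < t j ∧ t j < 1}

/-- `(0,1)` is `ℚ`-semialgebraic. [BCR1998 §2.1] -/
theorem isSemialgebraic_ivSet : IsSemialgebraic ℚ ivSet := isSemialgebraic_cubeSet 1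

/-- `(0,1) ⊆ [0,1]`. [folklore] -/
theorem ivSet_subset_Icc : ivSet ⊆ Icc 0 1 := fun _ ht => ⟨fun j => (ht j).1.le, fun j => (ht j).2.le⟩

/-- `arcRep w = [(0,1), w/(2((1 − t)² + t²))]`: a rational weight on the unit interval (value `w·π/4`).
[KontsevichZagier2001 §1.1] -/
def arcRep (w : ℚ) : KZ.IntegralRep 1 where
  domain := ivSet
  integrand t := (w : ℝ) / (2 * ((1 - t 0) ^ 2 + t 0 ^ 2))
  isSemialgebraic_domain := isSemialgebraic_ivSet
  isSemialgebraicFunOn_integrand :=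
    (isSemialgebraicFunOn_aeval_div_aeval isSemialgebraic_ivSet (C w) (2 * ((1 - X 0) ^ 2 + X 0 ^ 2))
      fun t _ => by simpa using (mul_pos two_pos (gq_pos (t 0))).ne').congr fun t _ => by simp
  integrableOn := by
    refine (ContinuousOn.integrableOn_compact isCompact_Icc ?_).mono_set ivSet_subset_Icc
    have hc : Continuous fun t : Fin 1 → ℝ => (w : ℝ) / (2 * ((1 - t 0) ^ 2 + t 0 ^ 2)) := by
      refine continuous_const.div ?_ fun t => (mul_pos two_pos (gq_pos (t 0))).ne'
      exact continuous_const.mul (((continuous_const.sub (continuous_apply 0)).pow 2).add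
        ((continuous_apply 0).pow 2))
    exact hc.continuousOn

/-- The domain of `arcRep w`. [definition] -/
@[simp] theorem arcRep_domain (w : ℚ) : (arcRep w).domain = ivSet := rfl

/-- The integrand of `arcRep w`. [definition] -/
@[simp] theorem arcRep_integrand (w : ℚ) (t : Fin 1 → ℝ) :
    (arcRep w).integrand t = (w : ℝ) / (2 * ((1 - t 0) ^ 2 + t 0 ^ 2)) := rfl

/-- **`arcRep w` is a rational representation of dimension 1.** [KontsevichZagier2001 §1.1] -/
theorem isRational_arcRep (w : ℚ) : (arcRep w).IsRational := by
  refine ⟨C w, 2 * ((1 - X 0) ^ 2 + X 0 ^ 2), fun t _ => ?_, fun t _ => ?_⟩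
  · simpa using (mul_pos two_pos (gq_pos (t 0))).ne'
  · simp

/-! #### The source domain `D₁` and the source representation of the planar chart -/

/-- The disc polynomial pulled back along `Φ`: `1 − (y₁(1 − y₀))² − (y₁y₀)²`. -/
def dSrcPoly : MvPolynomial (Fin 2) ℚ := 1 - (X 1 * (1 - X 0)) ^ 2 - (X 1 * X 0) ^ 2

/-- Evaluation of the pulled-back polynomial. [definition] -/
@[simp] theorem aeval_dSrcPoly (y : Fin 2 → ℝ) :
    aeval y dSrcPoly = 1 - (y 1 * (1 - y 0)) ^ 2 - (y 1 * y 0) ^ 2 := by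
  simp [dSrcPoly]

/-- The source domain `D₁ = {y | y₀ ∈ (0,1), 0 < y₁, dSrcPoly(y) > 0}`. -/
def dSrcSet : Set (Fin 2 → ℝ) :=
  {y | Fin.init y ∈ ivSet ∧ 0 < y (Fin.last 1) ∧ 0 < aeval y dSrcPoly}

/-- Membership in `D₁`, in coordinates. [definition] -/
theorem mem_dSrcSet {y : Fin 2 → ℝ} :
    y ∈ dSrcSet ↔ (0 < y 0 ∧ y 0 < 1) ∧ 0 < y 1 ∧ 0 < 1 - (y 1 * (1 - y 0)) ^ 2 - (y 1 * y 0) ^ 2 := by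
  simp only [dSrcSet, ivSet, mem_setOf_eq, aeval_dSrcPoly, Fin.init]
  exact ⟨fun ⟨hu, h1, hP⟩ => ⟨hu 0, h1, hP⟩, fun ⟨h0, h1, hP⟩ =>
    ⟨fun j => by fin_cases j; exact h0, h1, hP⟩⟩

/-- `D₁` is `ℚ`-semialgebraic. [BCR1998 §2.1] -/
theorem isSemialgebraic_dSrcSet : IsSemialgebraic ℚ dSrcSet := by
  have h := ((isSemialgebraic_ivSet.setOf_init_mem).inter
    (isSemialgebraic_setOf_eval_pos (X (Fin.last 1) : MvPolynomial (Fin 2) ℚ))).inter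
    (isSemialgebraic_setOf_eval_pos dSrcPoly)
  convert h using 1
  ext y
  simp only [dSrcSet, mem_setOf_eq, mem_inter_iff, MvPolynomial.aeval_X, and_assoc]

/-- `D₁ ⊆ [0,2]²` (`y₁ = y₁(1 − y₀) + y₁y₀ < 2`). [folklore] -/
theorem dSrcSet_subset_Icc : dSrcSet ⊆ Icc 0 2 := by
  intro y hy
  rw [mem_dSrcSet] at hy
  obtain ⟨h0, h1, hP⟩ := hy
  have ha : y 1 * (1 - y 0) < 1 := by
    have hpos : 0 < y 1 * (1 - y 0) := mul_pos h1 (by linarith [h0.2])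
    nlinarith [sq_nonneg (y 1 * y 0)]
  have hb : y 1 * y 0 < 1 := by
    have hpos : 0 < y 1 * y 0 := mul_pos h1 h0.1
    nlinarith [sq_nonneg (y 1 * (1 - y 0))]
  have h1' : y 1 < 2 := by nlinarith
  refine ⟨fun j => ?_, fun j => ?_⟩
  · fin_cases j
    · exact h0.1.le
    · exact h1.le
  · fin_cases j
    · simpa using (h0.2.trans one_lt_two).le
    · simpa using h1'.le

/-- `[D₁, w·y₁]`: the source representation of the planar chart. [KontsevichZagier2001 §1.1] -/
def dSrcRep (w : ℚ) : KZ.IntegralRep 2 where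
  domain := dSrcSet
  integrand y := (w : ℝ) * y 1
  isSemialgebraic_domain := isSemialgebraic_dSrcSet
  isSemialgebraicFunOn_integrand :=
    (isSemialgebraicFunOn_aeval isSemialgebraic_dSrcSet (C w * X 1)).congr fun y _ => by simp
  integrableOn :=
    ((continuous_const.mul (continuous_apply 1)).continuousOn.integrableOn_compact
      isCompact_Icc).mono_set dSrcSet_subset_Icc

/-- The domain of the source representation. [definition] -/
@[simp] theorem dSrcRep_domain (w : ℚ) : (dSrcRep w).domain = dSrcSet := rfl

/-- The integrand of the source representation. [definition] -/
@[simp] theorem dSrcRep_integrand (w : ℚ) (y : Fin 2 → ℝ) : (dSrcRep w).integrand y = (w : ℝ) * y 1 :=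
  rfl

/-! #### The planar Dirichlet-polar chart `Φ(y) = (y₁(1 − y₀), y₁y₀)` -/

/-- The chart as a polynomial map. -/
def phiPoly : Fin 2 → MvPolynomial (Fin 2) ℚ := ![X 1 * (1 - X 0), X 1 * X 0]

/-- `Φ(y) = (y₁(1 − y₀), y₁y₀)`. -/
def phi : (Fin 2 → ℝ) → (Fin 2 → ℝ) := fun y j => aeval y (phiPoly j)

/-- `Φ(y)₀ = y₁(1 − y₀)`. [definition] -/
@[simp] theorem phi_zero (y : Fin 2 → ℝ) : phi y 0 = y 1 * (1 - y 0) := by simp [phi, phiPoly]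

/-- `Φ(y)₁ = y₁y₀`. [definition] -/
@[simp] theorem phi_one (y : Fin 2 → ℝ) : phi y 1 = y 1 * y 0 := by simp [phi, phiPoly]

/-- The Jacobian matrix of `Φ`. -/
def phiMat (y : Fin 2 → ℝ) : Matrix (Fin 2) (Fin 2) ℝ := !![-(y 1), 1 - y 0; y 1, y 0]

/-- The derivative of `Φ` as a continuous linear map. -/
def phi' (y : Fin 2 → ℝ) : (Fin 2 → ℝ) →L[ℝ] (Fin 2 → ℝ) :=
  LinearMap.toContinuousLinearMap (Matrix.toLin' (phiMat y))

/-- `Φ'(y)` acts by the Jacobian matrix. [calculus] -/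
theorem phi'_apply (y v : Fin 2 → ℝ) (a : Fin 2) : phi' y v a = ∑ b, phiMat y a b * v b := by
  change Matrix.toLin' (phiMat y) v a = _
  rw [Matrix.toLin'_apply]
  rfl

/-- `det Φ'(y) = −y₁`. [calculus] -/
theorem phi'_det (y : Fin 2 → ℝ) : (phi' y).det = -(y 1) := by
  change LinearMap.det (Matrix.toLin' (phiMat y)) = _
  rw [LinearMap.det_toLin', phiMat, Matrix.det_fin_two]
  simp
  ring

/-- `Φ` is differentiable with derivative `Φ'`. [calculus] -/
theorem hasFDerivAt_phi (y : Fin 2 → ℝ) : HasFDerivAt phi (phi' y) y := by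
  have h0 : HasFDerivAt (fun z : Fin 2 → ℝ => phi z 0)
      ((ContinuousLinearMap.proj 0).comp (phi' y)) y := by
    have hf : (fun z : Fin 2 → ℝ => phi z 0) = fun z => z 1 * (1 - z 0) := funext phi_zero
    rw [hf]
    refine ((hasFDerivAt_apply 1 y).mul ((hasFDerivAt_apply 0 y).const_sub 1)).congr_fderiv
      (ContinuousLinearMap.ext fun v => ?_)
    simp [phi'_apply, phiMat, Fin.sum_univ_two]
  have h1 : HasFDerivAt (fun z : Fin 2 → ℝ => phi z 1)
      ((ContinuousLinearMap.proj 1).comp (phi' y)) y := by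
    have hf : (fun z : Fin 2 → ℝ => phi z 1) = fun z => z 1 * z 0 := funext phi_one
    rw [hf]
    refine ((hasFDerivAt_apply 1 y).mul (hasFDerivAt_apply 0 y)).congr_fderiv
      (ContinuousLinearMap.ext fun v => ?_)
    simp [phi'_apply, phiMat, Fin.sum_univ_two]
  refine hasFDerivAt_pi'' fun a => ?_
  fin_cases a
  · exact h0
  · exact h1

/-- `Φ` is injective where `y₁ > 0`. [calculus] -/
theorem injOn_phi : InjOn phi {y | 0 < y 1} := by
  intro x hx y _ hxy
  have e0 : x 1 * (1 - x 0) = y 1 * (1 - y 0) := by simpa using congrFun hxy 0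
  have e1 : x 1 * x 0 = y 1 * y 0 := by simpa using congrFun hxy 1
  have h1 : x 1 = y 1 := by linear_combination e0 + e1
  have h0 : x 0 = y 0 := by
    have h : x 1 * x 0 = x 1 * y 0 := by rw [e1, h1]
    exact mul_left_cancel₀ (ne_of_gt hx) h
  funext a
  fin_cases a
  · exact h0
  · exact h1

/-- `Φ` maps `D₁` onto the quarter disc `Q` (inverse `y = (x₁/(x₀+x₁), x₀+x₁)`). [calculus] -/
theorem image_phi : phi '' dSrcSet = {x | (∀ j, 0 < x j ∧ x j < 1) ∧ 0 < aeval x discPoly} := by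
  ext x
  simp only [mem_image, mem_setOf_eq, aeval_discPoly]
  constructor
  · rintro ⟨y, hy, rfl⟩
    rw [mem_dSrcSet] at hy
    obtain ⟨h0, h1, hP⟩ := hy
    have ha0 : 0 < y 1 * (1 - y 0) := mul_pos h1 (by linarith [h0.2])
    have hb0 : 0 < y 1 * y 0 := mul_pos h1 h0.1
    have ha : y 1 * (1 - y 0) < 1 := by nlinarith [sq_nonneg (y 1 * y 0)]
    have hb : y 1 * y 0 < 1 := by nlinarith [sq_nonneg (y 1 * (1 - y 0))]
    refine ⟨fun j => ?_, by simpa using hP⟩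
    fin_cases j
    · simpa using ⟨ha0, ha⟩
    · simpa using ⟨hb0, hb⟩
  · rintro ⟨hx, hP⟩
    have hx0 := hx 0
    have hx1 := hx 1
    have hs : 0 < x 0 + x 1 := add_pos hx0.1 hx1.1
    have hne : x 0 + x 1 ≠ 0 := hs.ne'
    refine ⟨![x 1 / (x 0 + x 1), x 0 + x 1], ?_, ?_⟩
    · rw [mem_dSrcSet]
      simp only [Matrix.cons_val_zero, Matrix.cons_val_one]
      refine ⟨⟨div_pos hx1.1 hs, (div_lt_one hs).2 (by linarith [hx0.1])⟩, hs, ?_⟩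
      have e0 : (x 0 + x 1) * (1 - x 1 / (x 0 + x 1)) = x 0 := by field_simp; ring
      have e1 : (x 0 + x 1) * (x 1 / (x 0 + x 1)) = x 1 := by field_simp
      rw [e0, e1]
      linarith
    · funext a
      fin_cases a
      · simp only [Fin.reduceFinMk, phi_zero, Matrix.cons_val]
        field_simp
        ring
      · simp only [Fin.reduceFinMk, phi_one, Matrix.cons_val]
        field_simp

/-- **Move (2), planar chart:** `[D₁, w·y₁] − [Q, w] ∈ KZ.relations` (`|det Φ'| = y₁`).
[KontsevichZagier2001 §1.2 rule (2)] -/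
theorem of_dSrcRep_sub_of_disc_mem_relations (w : ℚ) :
    KZ.of (dSrcRep w) - KZ.of (cellRep discPoly w) ∈ KZ.relations := by
  refine KZ.changeOfVariablesRel_subset_relations
    ⟨2, dSrcRep w, cellRep discPoly w, phi, phi', ?_,
      fun y _ => (hasFDerivAt_phi y).hasFDerivWithinAt,
      injOn_phi.mono fun y hy => (mem_dSrcSet.1 hy).2.1, ?_, fun y hy => ?_, rfl⟩
  · exact isSemialgebraicMapOn_aeval (dSrcRep w).isSemialgebraic_domain phiPoly
  · rw [cellRep_domain, dSrcRep_domain, image_phi]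
  · have h1 : 0 < y 1 := (mem_dSrcSet.1 hy).2.1
    rw [dSrcRep_integrand, cellRep_integrand, phi'_det, abs_neg, abs_of_pos h1]

/-! #### The band: `D₁` is the open band `0 < y₁ < 1/√((1 − t)² + t²)` over `(0,1)` -/

/-- Coordinates of `Fin.snoc` on `ℝ¹ × ℝ`. [definition] -/
@[simp] private theorem snoc₁_apply (t : Fin 1 → ℝ) (s : ℝ) :
    (Fin.snoc t s : Fin 2 → ℝ) 1 = s ∧ (Fin.snoc t s : Fin 2 → ℝ) 0 = t 0 := ⟨rfl, rfl⟩

/-- The upper edge `e(t) = √(1/((1 − t)² + t²))` of the band. -/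
def dEdge (t : Fin 1 → ℝ) : ℝ := √(1 / ((1 - t 0) ^ 2 + t 0 ^ 2))

/-- The upper edge is `ℚ`-semialgebraic on `(0,1)`. [BCR1998 §2.2] -/
theorem isSemialgebraicFunOn_dEdge : IsSemialgebraicFunOn ℚ ivSet dEdge :=
  (IsSemialgebraicFunOn.sqrt_holds
    (isSemialgebraicFunOn_aeval_div_aeval isSemialgebraic_ivSet (1 : MvPolynomial (Fin 1) ℚ)
      ((1 - X 0) ^ 2 + X 0 ^ 2) fun t _ => by simpa using (gq_pos (t 0)).ne')).congr fun t _ => by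
    simp [dEdge]

/-- `e(t)² = 1/((1 − t)² + t²)`. [folklore] -/
theorem dEdge_sq (t : Fin 1 → ℝ) : dEdge t ^ 2 = 1 / ((1 - t 0) ^ 2 + t 0 ^ 2) :=
  Real.sq_sqrt (div_pos one_pos (gq_pos (t 0))).le

/-- `e(t) < 2`. [folklore] -/
theorem dEdge_lt_two (t : Fin 1 → ℝ) : dEdge t < 2 := by
  refine (Real.sqrt_lt' two_pos).2 ((div_lt_iff₀ (gq_pos (t 0))).2 ?_)
  nlinarith [half_le_gq (t 0)]

/-- Membership in `D₁` in band form. [folklore] -/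
theorem mem_dSrcSet_iff_init (y : Fin 2 → ℝ) :
    y ∈ dSrcSet ↔ Fin.init y ∈ ivSet ∧ 0 < y (Fin.last 1) ∧ y (Fin.last 1) < dEdge (Fin.init y) := by
  rw [mem_dSrcSet]
  have hG := gq_pos (y 0)
  have key : y 1 ^ 2 * ((1 - y 0) ^ 2 + y 0 ^ 2) = (y 1 * (1 - y 0)) ^ 2 + (y 1 * y 0) ^ 2 := by
    ring
  have hiv : Fin.init y ∈ ivSet ↔ (0 < y 0 ∧ y 0 < 1) := by
    simp only [ivSet, mem_setOf_eq, Fin.init]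
    exact ⟨fun hu => hu 0, fun h0 j => by fin_cases j; exact h0⟩
  have hb : dEdge (Fin.init y) = √(1 / ((1 - y 0) ^ 2 + y 0 ^ 2)) := rfl
  have hl : y (Fin.last 1) = y 1 := rfl
  rw [hiv, hb, hl]
  constructor
  · rintro ⟨h0, h1, hP⟩
    refine ⟨h0, h1, (Real.lt_sqrt h1.le).2 ((lt_div_iff₀ hG).2 ?_)⟩
    rw [key]
    linarith
  · rintro ⟨h0, h1, hlt⟩
    have h' : y 1 ^ 2 < 1 / ((1 - y 0) ^ 2 + y 0 ^ 2) := (Real.lt_sqrt h1.le).1 hlt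
    have h'' : y 1 ^ 2 * ((1 - y 0) ^ 2 + y 0 ^ 2) < 1 := (lt_div_iff₀ hG).1 h'
    refine ⟨h0, h1, ?_⟩
    rw [key] at h''
    linarith

/-- The closed band lies in `[0,2]²`. [folklore] -/
theorem band_ivSet_subset_Icc : KZlog.band ivSet (fun _ => (0:ℝ)) dEdge ⊆ Icc 0 2 := by
  intro y hy
  rw [KZlog.mem_band] at hy
  obtain ⟨hu, h0, h1⟩ := hy
  have hlt := dEdge_lt_two (Fin.init y)
  refine ⟨fun j => ?_, fun j => ?_⟩
  · fin_cases j
    · exact (hu 0).1.le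
    · exact h0
  · fin_cases j
    · exact ((hu 0).2.trans one_lt_two).le
    · exact (h1.trans hlt.le)

/-! #### Moves (3) + (1a): `[D₁, w·y₁] ≡ arcRep w`, hence `[Q, w] ≡ arcRep w` -/

/-- **Moves (3) + (1a):** Newton–Leibniz along `y₁` with the primitive `w·y₁²/2` over `(0,1)` (closed
fibres `[0, e(t)]`), then opening the fibres: `[D₁, w·y₁] − arcRep w ∈ KZ.relations`.
[KontsevichZagier2001 §1.2 rules (1), (3)] -/
theorem of_dSrcRep_sub_of_arcRep_mem_relations (w : ℚ) :
    KZ.of (dSrcRep w) - KZ.of (arcRep w) ∈ KZ.relations := by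
  have hBs := isSemialgebraic_ivSet
  have ha : IsSemialgebraicFunOn ℚ ivSet (fun _ => (0:ℝ)) := by
    simpa using isSemialgebraicFunOn_ratCast hBs 0
  have hb : IsSemialgebraicFunOn ℚ ivSet dEdge := isSemialgebraicFunOn_dEdge
  have hband : IsSemialgebraic ℚ (KZlog.band ivSet (fun _ => (0:ℝ)) dEdge) :=
    KZlog.isSemialgebraic_band ha hb
  set F : (Fin 2 → ℝ) → ℝ := fun y => (w : ℝ) * y 1 ^ 2 / 2 with hFdef
  have hbdry : ∀ t ∈ ivSet,
      F (Fin.snoc t (dEdge t)) - F (Fin.snoc t ((fun _ => (0:ℝ)) t)) = (arcRep w).integrand t := by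
    intro t _
    simp only [hFdef, snoc₁_apply, arcRep_integrand]
    rw [dEdge_sq t]
    have hG0 := (gq_pos (t 0)).ne'
    field_simp
    ring
  obtain ⟨rb, rd, hrbd, hrbi, hrdd, hrdi, hrel⟩ := KZ.exists_band_newtonLeibniz hBs
    (fun _ => (0:ℝ)) dEdge ha hb (fun _ _ => Real.sqrt_nonneg _) F (fun y => (w : ℝ) * y 1)
    ((isSemialgebraicFunOn_aeval hband (C (w / 2) * X 1 ^ 2)).congr fun y _ => by
        simp only [hFdef]
        simp
        ring)
    ((isSemialgebraicFunOn_aeval hband (C w * X 1)).congr fun y _ => by simp)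
    (fun t _ => by
      simp only [hFdef, snoc₁_apply]
      exact ((continuous_const.mul (continuous_pow 2)).div_const _).continuousOn)
    (fun t _ s _ => by
      simp only [hFdef, snoc₁_apply]
      exact (((hasDerivAt_pow 2 s).const_mul (w : ℝ)).div_const 2).congr_deriv (by ring))
    (((continuous_const.mul (continuous_apply 1)).continuousOn.integrableOn_compact
      isCompact_Icc).mono_set band_ivSet_subset_Icc)
    ((arcRep w).isSemialgebraicFunOn_integrand.congr fun t ht => (hbdry t ht).symm)
    (((arcRep w).integrableOn.congr_fun (fun t ht => (hbdry t ht).symm)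
      isSemialgebraic_ivSet.measurableSet_holds))
  obtain ⟨rb', hrb'd, hrb'i, hrel'⟩ := KZ.of_sub_of_restrict_openBand_mem_relations ha hb rb hrbd
  have hpin1 : KZ.of rb' - KZ.of (dSrcRep w) ∈ KZ.relations := by
    refine KZ.of_sub_of_mem_relations_of_eqOn ?_ fun y _ => ?_
    · rw [hrb'd, dSrcRep_domain]
      ext y
      exact mem_dSrcSet_iff_init y
    · rw [hrb'i, hrbi]
      rfl
  have hpin2 : KZ.of rd - KZ.of (arcRep w) ∈ KZ.relations := by
    refine KZ.of_sub_of_mem_relations_of_eqOn ?_ fun t ht => ?_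
    · rw [arcRep_domain, hrdd]
    · rw [hrdi]
      rw [hrdd] at ht
      exact hbdry t ht
  have : KZ.of (dSrcRep w) - KZ.of (arcRep w) =
      (KZ.of rb - KZ.of rd) - (KZ.of rb - KZ.of rb') - (KZ.of rb' - KZ.of (dSrcRep w)) +
        (KZ.of rd - KZ.of (arcRep w)) := by abel
  rw [this]
  exact add_mem (sub_mem (sub_mem hrel hrel') hpin1) hpin2

/-- **`[Q, w] − arcRep w ∈ KZ.relations`:** the quarter disc with constant weight `w` is equivalent
inside the rules to the RATIONAL 1-cell `[(0,1), w/(2((1 − t)² + t²))]` (two moves + one fibre-opening).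
[KontsevichZagier2001 §1.2; this node] -/
theorem of_disc_sub_of_arcRep_mem_relations (w : ℚ) :
    KZ.of (cellRep discPoly w) - KZ.of (arcRep w) ∈ KZ.relations := by
  have h1 := of_dSrcRep_sub_of_disc_mem_relations w
  have h2 := of_dSrcRep_sub_of_arcRep_mem_relations w
  have : KZ.of (cellRep discPoly w) - KZ.of (arcRep w) =
      (KZ.of (dSrcRep w) - KZ.of (arcRep w)) - (KZ.of (dSrcRep w) - KZ.of (cellRep discPoly w)) := by
    abel
  rw [this]
  exact sub_mem h2 h1

end Summit.KontsevichZagierPeriods.RootDecompWalshStrata.Ball4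

end
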